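import Mathlib.NumberTheory.Padics.PadicNumbers
import Mathlib.Data.ZMod.Basic
import HarnessLib
import HarnessLib.Audit.Tags

/-!
# A twisted D-valued p-adic BSD conjecture at an additive potentially-supersingular prime (Gss2 = O5a,
# `e = 2`) — conjecture T-O5-PR and its HEIGHT-FREE `log²` face F1; census record schema
# (cell `b2b-bsdres`, lane CLASS-CLOSURE §3.5 O5; content = planner o5-r2 GEN 12, non-Iwasawa side) — TYPED, NOTHING ASSERTED

(PLACED by cc-typer-5 GEN 15 — o5-r2 GEN 12 A-O5-PR0, INBOX 2026-08-22T10:17:56Z l.11215–11221, 'discretionary, nothing owed';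
 cc-lead GEN 57 PS l.11224 placement words; source `HOME/b2b-bsdres-o5-r2/gen12/lean/TwistedSupersingularPadicBSD.lean` sha16
 `270b1ccdd2c29584`, decl bodies byte-identical; memo `gen12/O5-GEN12.md`, result `gen12/pr3/PR3-RESULT.md`; 0 Literature facts.)

LABEL (cc-lead GEN 57 / X44-REPORT line 1, verbatim in kind): **OBJECT CANDIDATE for O5 — nothing formulated in print; a data-mined
candidate object; the `r = 0` identity is CALIBRATION-type, NOT a BSD result, never confirmed, never a Literature fact; the `r = 1`
rows are INSTANCE DATA for a research conjecture not formulated in print for `p ∣ d`** (o5-r2's locators: Delbourgo 1998 p. 152 /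
[corpus:paper:delbourgo1998 p. 30] open question; Kurihara–Pollack (2.6) [corpus:book:burns2007 p. 351] needs `gcd(d, Np) = 1`;
Delbourgo 2002 [corpus:paper:delbourgo2002 pp. 1–3] potentially ORDINARY only; null: `lit vsearch` k = 10 and galaxy `--star all`
needles — typer re-ran "twisted p-adic BSD|potentially supersingular|D-valued height" 2026-08-22: nothing further).  The RECORDS files
(`…RecordsF1/F2.lean`, 728 rows each, chunked `decide`) are EVIDENCE records; they are NOT placed in this proposal (size > `lint.size`
per file at one-at-the-gate; successor item on o5-r2's or cc-lead's word) and NOTHING under `O5/` imports them or this file into a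
CLASS END; no RESIDUAL-MAP / O5 status word moves (O5 OPEN).  Census VALID words of record: census-lead G-34 (requests l.2814 F2
σ-face j157273 deposit re-derived 728/728, P-F2 PASS as registered held-out 250/250; l.2842 F1 j156501 deposit re-derived 728/728).

HONEST FRAMING (cell `b2b-bsdres`, verbatim): the goal of the cell is to DELETE the COMBINATION-SHAPED
residual classes of the BSD formula for all analytic-rank `≤ 1` curves over `ℚ`, assembled strictly from
published theorems; the remainder is TYPED, not attempted. §3.5 O5 is a research route: census output is
EVIDENCE / conjecture items, never a Literature fact; no `_holds`; nothing is booked; no mark of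
`RESIDUAL-MAP.md` moves. This file answers the ttrl3 X44 relay ("LOCATED GAP for the formulate team: no
height side" for the `r = 1` rows of locus Gss2).

SETTING. `p` odd, `d = p* = (−1)^{(p−1)/2} p`, `E♭/ℚ` good supersingular at `p`, `E = E♭ ⊗ χ_d` (additive
at `p`, `v_p(N) = 2`, potentially supersingular, `e = 2`). `D = D_dR(V_p E♭)` with PARI's basis `(ω♭, η♭)`
of the reduced minimal model, Frobenius matrix `M` (`φ ω♭ = M₁₁ ω♭ + M₂₁ η♭`, `det M = p`, `tr M = ã`).
X44's analytic object `A1 = (a₁, b₁) := ellpadicL(E♭, p, n, [0,(p−1)/2], 1)` = the first derivative at the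
trivial point of the `χ_d`-branch of the D-valued p-adic L-function of `E♭`, in the basis `(ω♭, F ω♭)`.
`ψ : E ≅ E♭` over `ℚ(√d)`, `ψ^* ω♭ = w ω_E`, `W := w² = (c₆(E)/c₆(E♭))/(c₄(E)/c₄(E♭)) ∈ ℚ`, `d/W` a square.

CONJECTURE T-O5-PR (EVIDENCE-shaped; the case `p ∣ d` is not formulated in print: Kurihara–Pollack (2.6)
[burns2007 p.351] needs `gcd(d, Np) = 1`; Delbourgo 1998 p.152 forecasts leading-term formulas for
potentially supersingular reduction): `A1(E) = c_∞(E) · (#Ш ∏ c_ℓ / #E(ℚ)_tors²) · (F/p) · h̃(P̂)` with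
`h̃ = w · ψ_* h_D^E(P̂)` the transported D-valued cyclotomic height; coordinates `h̃ = f̃ ω♭ + g̃ η♭`,
`g̃ = −W · log_E(P̂)²` (elementary), `f̃ = f_E + r_ψ g_E` (σ-part). Faces in the basis `(ω♭, Fω♭)`:
  F1 (height-free):  `a₁ · M₂₁ = c_∞ · C′ · W · log_E(P̂)²`,  `C′ = #Ш ∏c_ℓ / #T²`;
  F2 (σ-face):       `b₁ = c_∞ C′ (α̃ + ã β̃)/p`, `α̃ = f̃ − g̃ M₁₁/M₂₁`, `β̃ = g̃/M₂₁`.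
CALIBRATION (PARI 2.15.4, good supersingular `p`, rank 1; probe kit j156224): `ellpadicheight = [f, g]` with
`g = −log_ω(P)²` exactly; `(1 − F/p)^{−2} L_p'(E, 𝟙) = c_∞ · (∏c·Ш/#T²) · h_D(P̂)` on 6/6 curves.
CENSUS PR3 (pre-registration `HOME/b2b-bsdres-o5-r2/gen12/pr3/PR3-PREREG.md` sha16 3e10454aae161c2f, kit
j156501; smoke j156423: F1 to the last delivered digit on the 8 SEEN probe rows).

Contents: §1 the INTERFACE `TwistedDValuedDatum p` (the p-adic quantities of one row as elements of `ℚ_[p]`;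
data, no axioms — existence/values are supplied by computation, never asserted); §2 the faces `F1Face`,
`F2Face` as `Prop`s over the interface and the conjecture node `TwistedSupersingularPadicBSD` (every datum
produced by the registered engine satisfies both faces); §3 the census record schema `PR3Row` (unit parts
truncated modulo `p^k`) with the DECIDABLE row check `PR3Row.FitsF1`; rows and `decide`d table checks belong
in a sibling RECORDS file once the census is folded. Nothing asserted; no named fact.
-/

namespace Summit.BirchSwinnertonDyer.Rank1Residual.O5

/-! ## §1 Interface: one row's p-adic data (values in `ℚ_[p]`; data only) -/

/-- D-O5-PR1. The p-adic and arithmetic quantities attached to one pair `(E, E♭, p)` of locus Gss2, rank 1: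
X44's derivative vector `(a₁, b₁)`, the Frobenius entries `M₁₁, M₂₁` of `E♭`, the formal-group logarithm
`log_E(P̂)` of a Mordell–Weil generator on `E`'s minimal model, the σ-part `fE` of the D-valued height of `E`
(computable since kit j156490: `fE = −2p·h₀^E(P̂)`, Bernardi σ with `c = 0`, MST shape), and the rational invariants. -/
structure TwistedDValuedDatum (p : ℕ) [Fact p.Prime] where
  /-- `d = p*` -/
  d : ℤ
  /-- `ã = a_p(E♭) ∈ {0, ±3}` (`= 0` for `p ≥ 5`) -/
  atilde : ℤ
  /-- `ω♭`-coordinate of `A1` in the basis `(ω♭, Fω♭)` -/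
  a₁ : ℚ_[p]
  /-- `Fω♭`-coordinate of `A1` -/
  b₁ : ℚ_[p]
  /-- Frobenius entry `M₁₁` on `(ω♭, η♭)` -/
  M₁₁ : ℚ_[p]
  /-- Frobenius entry `M₂₁ = [ω♭, Fω♭]`-coordinate (valuation 1) -/
  M₂₁ : ℚ_[p]
  /-- `log_E(P̂)`, `P̂` a generator of `E(ℚ)/tors`, `ω_E` of the minimal model -/
  logE : ℚ_[p]
  /-- σ-part `f_E` of `h_D^E(P̂)` in `E`'s basis `(ω_E, η_E)` (PARI convention `g_E = −log_E²`); since the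
  calibration kit j156490 this is the COMPUTABLE quantity `f_E = −2p · h₀^E(P̂)`, `h₀^E` the Bernardi-σ (`c = 0`)
  cyclotomic height of `E`'s minimal model in Mazur–Stein–Tate shape `log_p(σ(z(Q))/d(Q))/(p m²)` — no free parameter. -/
  fE : ℚ_[p]
  /-- `W = w²` of the twisting isomorphism -/
  W : ℚ
  /-- `r_ψ = (W b₂(E♭) − b₂(E))/12` -/
  rψ : ℚ
  /-- `c_∞ = #π₀(E(ℝ))` -/
  cinf : ℕ
  /-- `#E(ℚ)_tors` -/
  tors : ℕ
  /-- `∏_ℓ c_ℓ(E)` -/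
  tam : ℕ
  /-- `#Ш(E)` (analytic order in the census) -/
  sha : ℕ

namespace TwistedDValuedDatum

variable {p : ℕ} [Fact p.Prime] (D : TwistedDValuedDatum p)

/-- `C′ = #Ш ∏c_ℓ / #T²`. -/
noncomputable def bsdQuot : ℚ_[p] := ((D.sha * D.tam : ℕ) : ℚ_[p]) / ((D.tors ^ 2 : ℕ) : ℚ_[p])

/-- `g̃ = −W log_E²`. -/
noncomputable def gTilde : ℚ_[p] := -((D.W : ℚ) : ℚ_[p]) * D.logE ^ 2

/-- `f̃ = f_E + r_ψ g_E`, `g_E = −log_E²`. -/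
noncomputable def fTilde : ℚ_[p] := D.fE + ((D.rψ : ℚ) : ℚ_[p]) * (-(D.logE ^ 2))

/-- `β̃ = g̃ / M₂₁`. -/
noncomputable def betaTilde : ℚ_[p] := D.gTilde / D.M₂₁

/-- `α̃ = f̃ − g̃ M₁₁/M₂₁`. -/
noncomputable def alphaTilde : ℚ_[p] := D.fTilde - D.gTilde * D.M₁₁ / D.M₂₁

/-! ## §2 The two faces and the conjecture node -/

/-- F1, the HEIGHT-FREE face: `a₁ · M₂₁ = c_∞ · C′ · W · log_E(P̂)²` (equivalently `a₁ = −c_∞ C′ β̃`). -/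
def F1Face : Prop := D.a₁ * D.M₂₁ = (D.cinf : ℚ_[p]) * D.bsdQuot * ((D.W : ℚ) : ℚ_[p]) * D.logE ^ 2

/-- F2, the σ-face: `p · b₁ = c_∞ · C′ · (α̃ + ã β̃)`. -/
def F2Face : Prop := (p : ℚ_[p]) * D.b₁ = (D.cinf : ℚ_[p]) * D.bsdQuot * (D.alphaTilde + (D.atilde : ℚ_[p]) * D.betaTilde)

end TwistedDValuedDatum

/-- T-O5-PR as an obligation node over a FAMILY of data (the rows the registered engine produces — supplied
as a hypothesis, never constructed here): every datum satisfies both faces. EVIDENCE-shaped conjecture;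
F1 is under census PR3, F2 awaits a σ-engine at an additive prime.
LABEL (cc-typer-5 GEN 15 per cc-lead GEN 57): OBJECT CANDIDATE for O5 — nothing formulated in print for `p ∣ d`; a data-mined
candidate object; `r = 0` identity CALIBRATION-type, NOT a BSD result, never confirmed, never a Literature fact; `r = 1` rows =
instance data.  INTENDED BINDING of `rows`: the set of `TwistedDValuedDatum p` produced by the registered engines `pr3_f1.gp`
9e587c110d1117a2 / `pr3_f2.gp` 7b7442168edecdbb on X44's Gss2 rank-1 rows (`rows_r1.gp` 286b6e3c4ce4f2c3) — values in `ℚ_[p]`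
supplied by computation, never constructed in the kernel; `∅` / `fun _ => False`-type bindings are NOT legitimate.
[evidence: o5-r2 GEN 12 census PR3 (prereg-1 gen12/pr3/PR3-PREREG.md 3e10454aae161c2f before kit j156501, fold v2 ad6debb88272fda4; prereg-2 PR3-F2-PREREG.md d40781f671a109d5 → 83d12b3007a07acf §5 k5 addendum pre-census, kit j157273, fold 89494ff0474b052a; 8 SEEN rows excluded from every denominator): F1 held-out 250/250, unseen-train 439/439 P0-clean (+ 31/31 P0-excluded vs delivered digits ⇒ 728/728), margin {0}; F2 held-out 250/250, unseen-train 470/470, seen 8/8, margin {0: 728}; controls exact (k1 425 fail / 303 pass, k2 0, k3 0, k4 446, k5 the 22 W-free rows, k6 72/72; F1 c1–c6 as registered); census-lead G-34 deposit re-derivations 728/728 (requests l.2814, l.2842); LIMITATIONS S = 1 and W = d on all 728 rows]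
[cite: Delbourgo1998, p. 152 (the forecast; nothing formulated for p ∣ d)] -/
@[conjecture] def TwistedSupersingularPadicBSD {p : ℕ} [Fact p.Prime]
    (rows : Set (TwistedDValuedDatum p)) : Prop :=
  ∀ D ∈ rows, D.F1Face ∧ D.F2Face

/-- Bookkeeping: the conjecture restricted to the height-free face. -/
def TwistedSupersingularPadicBSDLogFace {p : ℕ} [Fact p.Prime]
    (rows : Set (TwistedDValuedDatum p)) : Prop :=
  ∀ D ∈ rows, D.F1Face

/-- The full conjecture implies its height-free (`log²`, F1) face on the same family of data. Bookkeeping; nothing asserted about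
the family. [folklore] -/
theorem logFace_of_twistedSupersingularPadicBSD {p : ℕ} [Fact p.Prime]
    (rows : Set (TwistedDValuedDatum p)) (h : TwistedSupersingularPadicBSD rows) :
    TwistedSupersingularPadicBSDLogFace rows :=
  fun D hD => (h D hD).1

/-! ## §3 Census record schema (unit parts modulo `p^k`; decidable row check) -/

/-- One PR3 census row, truncated: every p-adic quantity `x` is stored as `(v(x), u(x) mod p^k)` with
`x = p^{v} u`; rationals exactly. `FitsF1` checks the F1 congruence of unit parts modulo `p^k` together with
the valuation balance. -/
structure PR3Row where
  /-- Cremona label of `E` with the prime, e.g. `"441d1@3"` -/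
  id : String
  p : ℕ
  /-- digits `k` to which the row is checked -/
  k : ℕ
  d : ℤ
  atilde : ℤ
  /-- `v_p(a₁)`, `a₁ / p^{v} mod p^k` -/
  va : ℤ
  ua : ℕ
  /-- `v_p(M₂₁)`, unit part -/
  vM : ℤ
  uM : ℕ
  /-- `v_p(log_E(P̂))`, unit part -/
  vL : ℤ
  uL : ℕ
  /-- `W = p^{vW} · uW` with `uW ∈ ℤ` prime to `p` -/
  vW : ℤ
  uW : ℤ
  cinf : ℕ
  tors : ℕ
  tam : ℕ
  sha : ℕ
  /-- X44's own `split` field: `true` = train (A1 recomputed in-job as a regression), `false` = test / held-out;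
  the two sets interleave in `N`. Nothing in PR3 is fitted on either. -/
  train : Bool
  deriving DecidableEq, Repr

namespace PR3Row

/-- `v_p` of a natural number, by structural recursion on a fuel argument (kernel-reducible, so that row
checks close by `decide`). -/
def vpAux (p : ℕ) : ℕ → ℕ → ℕ
  | 0, _ => 0
  | fuel + 1, n => if n ≠ 0 ∧ n % p = 0 then vpAux p fuel (n / p) + 1 else 0

/-- `v_p(n)` for `n : ℕ` (`0 ↦ 0`; for the rational factors `c_∞ Ш ∏c / T²`). -/
def vpNat (p n : ℕ) : ℕ := if p ≤ 1 then 0 else vpAux p n n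

/-- unit part of a natural number at `p` -/
def upNat (p n : ℕ) : ℕ := n / p ^ vpNat p n

/-- F1 row check: valuation balance `v(a₁) + v(M₂₁) = v(c_∞ Ш ∏c) − 2 v(T) + v(W) + 2 v(log)` and the
unit congruence `u(a₁) u(M₂₁) u(T)² ≡ u(c_∞ Ш ∏c) · uW · u(log)² (mod p^k)`. -/
def FitsF1 (r : PR3Row) : Bool :=
  let num := r.cinf * r.sha * r.tam
  (r.va + r.vM == (vpNat r.p num : ℤ) - 2 * (vpNat r.p r.tors : ℤ) + r.vW + 2 * r.vL) &&
  ((((r.ua * r.uM * upNat r.p r.tors ^ 2 : ℕ) : ℤ) - (upNat r.p num : ℤ) * r.uW * (r.uL ^ 2 : ℕ)) % (r.p ^ r.k : ℕ) == 0)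

end PR3Row

/-- Schema smoke test (one SEEN probe row, `441d1@3`, truncated to `k = 4`; values from kit j156423):
`a₁ = 2 + 3 + 2·9 + 27 + … ≡ 50`, `M₂₁ = 3 + 9 + 27 + 2·81 + … → u ≡ 67`,
`log = 1 + 3 + 2·9 + 27 + … ≡ 49 (mod 81)`, `W = −3`, `c_∞ = 1`, `T = 2`, `∏c = 4`, `Ш = 1`. -/
example : PR3Row.FitsF1 ⟨"441d1@3", 3, 4, -3, 0, 0, 50, 1, 67, 0, 49, 1, -1, 1, 2, 4, 1, true⟩ = true := by
  decide

/-- One census row for the σ-face **F2** in residue form. Every `p`-adic ingredient `x ∈ {b₁, M₂₁, M₁₁, f_E, g_E}`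
is recorded as the integer residue `X = x · p^c mod p^Kr` for one common shift `c ≥ 0` making all five integral;
`W = wnum / wden`, `S = #Ш_an·ν² = snum / sden`, `R = 12·r_ψ ∈ ℤ`. -/
structure PR3F2Row where
  id : String
  p : ℕ
  /-- absolute precision (as a power of `p`) to which the cleared identity is asserted -/
  Kr : ℕ
  /-- common shift -/
  c : ℕ
  /-- residues of `b₁ p^c`, `M₂₁ p^c`, `M₁₁ p^c`, `f_E p^c`, `g_E p^c` modulo `p^Kr` -/
  B : ℤ
  M : ℤ
  M1 : ℤ
  F : ℤ
  G : ℤ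
  /-- `R = 12 r_ψ = W·b₂(E♭) − b₂(E)` -/
  R : ℤ
  wnum : ℤ
  wden : ℤ
  snum : ℤ
  sden : ℤ
  atilde : ℤ
  cinf : ℕ
  tam : ℕ
  tors : ℕ
  train : Bool
  deriving DecidableEq, Repr

namespace PR3F2Row

/-- F2 row check, the cleared-denominator form of `p·b₁ = c_∞·C′·(α̃ + ã·β̃)`:
`12·wden·sden·p·T²·B·M ≡ c_∞·∏c·snum·(12·wden·F·M + wden·R·G·M + 12·wnum·G·(ã·p^c − M1)) (mod p^Kr)`. -/
def FitsF2 (r : PR3F2Row) : Bool :=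
  let lhs : ℤ := 12 * r.wden * r.sden * (r.p : ℤ) * (r.tors : ℤ) ^ 2 * r.B * r.M
  let rhs : ℤ := (r.cinf : ℤ) * (r.tam : ℤ) * r.snum *
    (12 * r.wden * r.F * r.M + r.wden * r.R * r.G * r.M + 12 * r.wnum * r.G * (r.atilde * (r.p : ℤ) ^ r.c - r.M1))
  (lhs - rhs) % ((r.p : ℤ) ^ r.Kr) == 0

end PR3F2Row

end Summit.BirchSwinnertonDyer.Rank1Residual.O5
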